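import Summits.Ventures.HSemireg.WedgeHankelSubstitutionJordan
import Summits.Ventures.HSemireg.WedgeHankelSubstitutionParabolic

/-!
# Venture HSemireg — TH-7's CLASS SPACE IS IRREDUCIBLE UNDER THE SUBSTITUTIONS WHEN `n! ≠ 0` IN `K`: every non-zero subspace of `spikeSpan n` stable under the shear
# `SbC(1 1 0 1)` and the swap `SbC(0 1 1 0)` is the whole class space (characteristic `0` or `p > n`; compare the Siegel classes for `n = p^e` in characteristic `p`)

HONEST FRAMING. Part of the Lean index of the computation cell `pub-hsemireg` (seat p10 gen 20, Sunday typer «UNIFORM-IN-n»).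
Finite-dimensional EXTERIOR ALGEBRA + linear algebra ONLY: no variety, no cohomology theory, no sheaf, no Ext group, no semiregularity map;
nothing here says that HC / HC_CM / HC_AV holds; no Literature fact is declared or used.  Custodian versions as in `WedgeHankelSiegelIdeal` (1/3) and `WedgeHankelFrameChange`;
the dictionary (the class space = `Sym^n` of the letters' plane, irreducible under `SL₂` in characteristic `0` and `p > n`) is QUOTED, never asserted.

WHAT IS IN THE TREE.  I18 (`WedgeHankelSubstitutionJordan`): `(SbC(shear λ) − 1)^{n+1} = 0`, `(SbC(shear λ) − 1)^k · w_n(q) = w_n((dMul λ)^k q)` with `(dMul λ)^k q` vanishing below `k`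
and `= k!·λ^k·q₀` at `k`; I8 (`WedgeHankelSubstitutionParabolic`): `Φs_eigen_mem_span_point` (for `λ ≠ 0` and `1, …, n ≠ 0` in `K` every eigenvector of the shear in the class
space is a multiple of the point class `E_n`), `cast_succ_ne_zero_of_factorial`; H1 `Φs_eq_Sb`, H5 `Sb_zero_eq_Ψs_Sb_lower`, I4 `Sb_diag_w`, E `Ψs_w`; gen 11 `w_eq_sum_spikes`.
THIS FILE (namespace `Summit.Ventures.HSemireg.Wedge.HankelFrameChange` continued; imports I18, I8) assembles the irreducibility:
* §242 `pow_apply_mem_of_forall_mem`, **`exists_mem_ker_of_nilpotent_stable`** (a subspace `W ≠ ⊥` stable under an endomorphism `N` with `N^m = 0` contains a non-zero vector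
  of `ker N`); `SbC_shear_one_eq_Φs` / `SbC_swap_spike_top` (`SbC(0 1 1 0) E_n = E_0`).
* §243 **`spike_top_mem_of_stable`** (`n! ≠ 0`: a non-zero shear-stable subspace of the class space contains the point class `E_n`), **`spike_zero_mem_of_stable`** (with the swap:
  it contains `E_0`), **`spike_mem_of_stable`** (then every `E_k`, by DOWNWARD induction on `k` along the Jordan chain `(SbC(shear 1) − 1)^k E_0 = k!·E_k + (higher spikes)`).
* §244 **`eq_top_of_shear_swap_stable`: for `n! ≠ 0` in `K`, every non-zero subspace of `spikeSpan n` stable under `SbC(1 1 0 1)` and `SbC(0 1 1 0)` is `⊤`** — th-7's class space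
  is an IRREDUCIBLE representation of the substitutions (indeed of the two unipotent/swap generators) in characteristic `0` or `p > n`; the companion file `WedgeHankelSiegelClassesStable`
  (this seat) shows it is REDUCIBLE for `n = p^e` in characteristic `p` (the Siegel classes).
NOT typed here: the sharp criterion in characteristic `p ≤ n` (irreducible iff every `C(n,j)` is a unit, i.e. all base-`p` digits of `n` below the top are `p − 1`); anything Ext-side.
New names only.
-/

open Module

namespace Summit.Ventures.HSemireg.Wedge.HankelFrameChange

open Summit.Ventures.HSemireg.Wedge Summit.Ventures.HSemireg.Wedge.Kunneth Summit.Ventures.HSemireg.Wedge.Hankel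
  Summit.Ventures.HSemireg.Wedge.BasisFree Summit.Ventures.HSemireg.Wedge.HankelSiegel Summit.Ventures.HSemireg.Wedge.HankelSiegelIdeal
  Summit.Ventures.HSemireg.Wedge.KunnethKernel Summit.Ventures.HSemireg.Wedge.HankelRankOne Summit.Ventures.HSemireg.Wedge.KernelDuality

variable (K : Type*) [Field K] {n : ℕ}

/-! ## §242. Generalities: a nilpotent-stable subspace has a kernel vector; the two generators on the extreme spikes -/

section Nilpotent

variable {V : Type*} [AddCommGroup V] [Module K V]

/-- a subspace stable under `N` is stable under every power of `N`. -/
theorem pow_apply_mem_of_forall_mem {N : V →ₗ[K] V} {W : Submodule K V} (hN : ∀ v ∈ W, N v ∈ W) {v : V} (hv : v ∈ W) (k : ℕ) : (N ^ k) v ∈ W := by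
  induction k with
  | zero => rwa [pow_zero, Module.End.one_apply]
  | succ k ih => rw [pow_succ', Module.End.mul_apply]; exact hN _ ih

/-- **a non-zero subspace stable under an endomorphism `N` with `N^m = 0` contains a non-zero vector killed by `N`** (run the chain `v, Nv, N²v, …` to its last non-zero term). -/
theorem exists_mem_ker_of_nilpotent_stable {N : V →ₗ[K] V} {m : ℕ} (hNm : N ^ m = 0) {W : Submodule K V} (hN : ∀ v ∈ W, N v ∈ W) (hW : W ≠ ⊥) :
    ∃ v ∈ W, v ≠ 0 ∧ N v = 0 := by
  classical
  obtain ⟨v₀, hv₀, hv₀0⟩ := (Submodule.ne_bot_iff W).mp hW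
  have hex : ∃ k, (N ^ k) v₀ = 0 := ⟨m, by rw [hNm, LinearMap.zero_apply]⟩
  have hk₀ : (N ^ Nat.find hex) v₀ = 0 := Nat.find_spec hex
  have hk₀pos : Nat.find hex ≠ 0 := fun h => hv₀0 (by rwa [h, pow_zero, Module.End.one_apply] at hk₀)
  obtain ⟨k, hk⟩ := Nat.exists_eq_succ_of_ne_zero hk₀pos
  refine ⟨(N ^ k) v₀, pow_apply_mem_of_forall_mem K hN hv₀ k, Nat.find_min hex (by omega), ?_⟩
  have hk' : k + 1 = Nat.find hex := by omega
  rw [← Module.End.mul_apply, ← pow_succ', hk', hk₀]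

end Nilpotent

/-- `SbC(1 1 0 1)` is the shear `Φs 1` on the underlying forms (H1 `Φs_eq_Sb`). -/
theorem SbC_shear_one_eq_Φs (f : spikeSpan K n) : (SbC K 1 1 0 1 f : HT K (In n)) = Φs K 1 (f : HT K (In n)) := by
  rw [SbC_apply_coe, ← Φs_eq_Sb]; rfl

/-- the swap substitution sends the point class to the pure class: `Sb 0 1 1 0 (E_n) = E_0` (H5 `Sb_zero_eq_Ψs_Sb_lower`, I4 `Sb_diag_w`, E `Ψs_w`). -/
theorem Sb_swap_w_spike_top : Sb K 0 1 1 0 (w K n n (fun j => if j = n then (1 : K) else 0)) = w K n n (fun j => if j = 0 then (1 : K) else 0) := by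
  rw [Sb_zero_eq_Ψs_Sb_lower, Sb_diag_w K 1 1 le_rfl, Ψs_w K le_rfl]
  refine (w_eq_w_iff K _ _).2 fun j hj => ?_
  rw [rev_apply_of_le K hj, one_pow, one_pow, one_mul, one_mul]
  by_cases h : j = 0
  · rw [if_pos (by omega), if_pos h]
  · rw [if_neg (by omega), if_neg h]

/-- class-space form: `SbC(0 1 1 0) E_n = E_0`. -/
theorem SbC_swap_spike_top :
    SbC K 0 1 1 0 (⟨w K n n (fun j => if j = n then (1 : K) else 0), w_mem_spikeSpan K _⟩ : spikeSpan K n) = ⟨w K n n (fun j => if j = 0 then (1 : K) else 0), w_mem_spikeSpan K _⟩ :=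
  Subtype.ext (by rw [SbC_apply_coe, Sb_swap_w_spike_top])

/-! ## §243. A stable subspace contains `E_n`, then `E_0`, then every spike -/

/-- **for `n! ≠ 0` in `K`, a non-zero subspace of the class space stable under the shear `SbC(1 1 0 1)` contains the POINT CLASS `E_n`** (§242 gives a fixed vector of the shear in
`W`; by I8 it is a multiple of `E_n`). -/
theorem spike_top_mem_of_stable (hfac : (n.factorial : K) ≠ 0) {W : Submodule K (spikeSpan K n)} (hU : ∀ f ∈ W, SbC K 1 1 0 1 f ∈ W) (hW : W ≠ ⊥) :
    (⟨w K n n (fun j => if j = n then (1 : K) else 0), w_mem_spikeSpan K _⟩ : spikeSpan K n) ∈ W := by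
  have hN : ∀ f ∈ W, (SbC K 1 1 0 1 - 1) f ∈ W := fun f hf => by
    rw [LinearMap.sub_apply, Module.End.one_apply]; exact Submodule.sub_mem _ (hU f hf) hf
  obtain ⟨f, hfW, hf0, hNf⟩ := exists_mem_ker_of_nilpotent_stable K (SbC_shear_sub_one_pow_succ K 1 (n := n)) hN hW
  have hfix : Φs K 1 (f : HT K (In n)) = (1 : K) • (f : HT K (In n)) := by
    rw [one_smul, ← SbC_shear_one_eq_Φs]
    rw [LinearMap.sub_apply, Module.End.one_apply, sub_eq_zero] at hNf
    rw [hNf]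
  have hfc : (f : HT K (In n)) ∈ coSiegel K n n := by rw [← spikeSpan_eq_coSiegel]; exact f.2
  have hf0' : (f : HT K (In n)) ≠ 0 := fun h => hf0 (Subtype.ext h)
  obtain ⟨-, hspan⟩ := Φs_eigen_mem_span_point K one_ne_zero (fun i hi => cast_succ_ne_zero_of_factorial hfac hi) hfc hf0' hfix
  obtain ⟨c, hc⟩ := Submodule.mem_span_singleton.mp hspan
  have hc0 : c ≠ 0 := by rintro rfl; exact hf0' (by rw [← hc, zero_smul])
  have e : (⟨w K n n (fun j => if j = n then (1 : K) else 0), w_mem_spikeSpan K _⟩ : spikeSpan K n) = c⁻¹ • f :=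
    Subtype.ext (by rw [Submodule.coe_smul, ← hc, smul_smul, inv_mul_cancel₀ hc0, one_smul])
  rw [e]
  exact Submodule.smul_mem _ _ hfW

/-- **… and, if it is also stable under the swap `SbC(0 1 1 0)`, it contains the PURE CLASS `E_0`.** -/
theorem spike_zero_mem_of_stable (hfac : (n.factorial : K) ≠ 0) {W : Submodule K (spikeSpan K n)} (hU : ∀ f ∈ W, SbC K 1 1 0 1 f ∈ W)
    (hS : ∀ f ∈ W, SbC K 0 1 1 0 f ∈ W) (hW : W ≠ ⊥) :
    (⟨w K n n (fun j => if j = 0 then (1 : K) else 0), w_mem_spikeSpan K _⟩ : spikeSpan K n) ∈ W := by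
  rw [← SbC_swap_spike_top]
  exact hS _ (spike_top_mem_of_stable K hfac hU hW)

/-- the Jordan chain from `E_0`: `(SbC(shear 1) − 1)^k E_0 = k!·E_k + Σ_{k<a≤n} r_a·E_a` — so if the higher spikes lie in `W` and so does the chain vector, `E_k ∈ W`. -/
theorem spike_mem_of_chain (hfac : (n.factorial : K) ≠ 0) {W : Submodule K (spikeSpan K n)} (hU : ∀ f ∈ W, SbC K 1 1 0 1 f ∈ W)
    (h0 : (⟨w K n n (fun j => if j = 0 then (1 : K) else 0), w_mem_spikeSpan K _⟩ : spikeSpan K n) ∈ W) {k : ℕ} (hk : k ≤ n)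
    (hhigh : ∀ a, k < a → a ≤ n → (⟨w K n n (fun j => if j = a then (1 : K) else 0), w_mem_spikeSpan K _⟩ : spikeSpan K n) ∈ W) :
    (⟨w K n n (fun j => if j = k then (1 : K) else 0), w_mem_spikeSpan K _⟩ : spikeSpan K n) ∈ W := by
  have hN : ∀ f ∈ W, (SbC K 1 1 0 1 - 1) f ∈ W := fun f hf => by
    rw [LinearMap.sub_apply, Module.End.one_apply]; exact Submodule.sub_mem _ (hU f hf) hf
  -- the chain vector and its window
  set r : ℕ → K := (dMul K 1)^[k] (fun j => if j = 0 then (1 : K) else 0) with hr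
  have hchain : (⟨w K n n r, w_mem_spikeSpan K r⟩ : spikeSpan K n) ∈ W := by
    rw [hr, ← SbC_shear_sub_one_pow_apply_w]
    exact pow_apply_mem_of_forall_mem K hN h0 k
  have hrk : r k = (k.factorial : K) := by rw [hr, iterate_dMul_apply_self, if_pos rfl, one_pow, mul_one, mul_one]
  have hrk0 : r k ≠ 0 := by
    rw [hrk]
    intro h
    apply hfac
    obtain ⟨c, hc⟩ := Nat.factorial_dvd_factorial hk
    rw [hc, Nat.cast_mul, h, zero_mul]
  -- expand the chain vector in spikes, inside the class space
  have hexp : (⟨w K n n r, w_mem_spikeSpan K r⟩ : spikeSpan K n) =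
      ∑ a ∈ Finset.range (n + 1), r a • (⟨w K n n (fun j => if j = a then (1 : K) else 0), w_mem_spikeSpan K _⟩ : spikeSpan K n) := by
    apply Subtype.ext
    simp only [Submodule.coe_sum, Submodule.coe_smul]
    exact w_eq_sum_spikes K r
  have hkmem : k ∈ Finset.range (n + 1) := Finset.mem_range.mpr (by omega)
  rw [hexp, ← Finset.add_sum_erase _ _ hkmem] at hchain
  -- the other terms lie in `W`
  have hrest : ∑ a ∈ (Finset.range (n + 1)).erase k, r a • (⟨w K n n (fun j => if j = a then (1 : K) else 0), w_mem_spikeSpan K _⟩ : spikeSpan K n) ∈ W := by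
    refine Submodule.sum_mem _ fun a ha => ?_
    rw [Finset.mem_erase, Finset.mem_range] at ha
    rcases lt_or_gt_of_ne ha.1 with hlt | hgt
    · rw [show r a = 0 from iterate_dMul_apply_of_lt K 1 k _ hlt, zero_smul]; exact Submodule.zero_mem _
    · exact Submodule.smul_mem _ _ (hhigh a hgt (by omega))
  have hkterm := Submodule.sub_mem _ hchain hrest
  rw [add_sub_cancel_right] at hkterm
  exact (Submodule.smul_mem_iff _ hrk0).mp hkterm

/-- **for `n! ≠ 0`: a subspace of the class space stable under the shear and containing `E_0` contains EVERY spike `E_k`, `k ≤ n`** (downward induction on `k`). -/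
theorem spike_mem_of_stable (hfac : (n.factorial : K) ≠ 0) {W : Submodule K (spikeSpan K n)} (hU : ∀ f ∈ W, SbC K 1 1 0 1 f ∈ W)
    (h0 : (⟨w K n n (fun j => if j = 0 then (1 : K) else 0), w_mem_spikeSpan K _⟩ : spikeSpan K n) ∈ W) {k : ℕ} (hk : k ≤ n) :
    (⟨w K n n (fun j => if j = k then (1 : K) else 0), w_mem_spikeSpan K _⟩ : spikeSpan K n) ∈ W := by
  -- downward induction: `P m := ∀ a, n - m ≤ a → a ≤ n → E_a ∈ W`
  have key : ∀ m, ∀ a, n - m ≤ a → a ≤ n → (⟨w K n n (fun j => if j = a then (1 : K) else 0), w_mem_spikeSpan K _⟩ : spikeSpan K n) ∈ W := by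
    intro m
    induction m with
    | zero =>
      intro a ha han
      exact spike_mem_of_chain K hfac hU h0 han fun b hb hbn => absurd hbn (by omega)
    | succ m ih =>
      intro a ha han
      by_cases ha' : n - m ≤ a
      · exact ih a ha' han
      · exact spike_mem_of_chain K hfac hU h0 han fun b hb hbn => ih b (by omega) hbn
  exact key n k (by omega) hk

/-! ## §244. Irreducibility -/

/-- **TH-7's CLASS SPACE IS IRREDUCIBLE UNDER THE SHEAR AND THE SWAP WHEN `n! ≠ 0` IN `K`: every non-zero subspace of `spikeSpan n` stable under `SbC(1 1 0 1)` and `SbC(0 1 1 0)`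
is `⊤`** (characteristic `0` or `p > n`).  Compare: for `n = p^e` in characteristic `p` the Siegel classes are a proper non-zero invariant subspace. -/
theorem eq_top_of_shear_swap_stable (hfac : (n.factorial : K) ≠ 0) {W : Submodule K (spikeSpan K n)} (hU : ∀ f ∈ W, SbC K 1 1 0 1 f ∈ W)
    (hS : ∀ f ∈ W, SbC K 0 1 1 0 f ∈ W) (hW : W ≠ ⊥) : W = ⊤ := by
  have h0 := spike_zero_mem_of_stable K hfac hU hS hW
  rw [eq_top_iff]
  intro f _
  -- expand `f` in th-7's spike basis
  rw [← (spikeBasis K n).sum_repr f]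
  refine Submodule.sum_mem _ fun p _ => Submodule.smul_mem _ _ ?_
  have e : spikeBasis K n p = ⟨w K n n (fun j => if j = (p : ℕ) then (1 : K) else 0), w_mem_spikeSpan K _⟩ := Subtype.ext (spikeBasis_coe K p)
  rw [e]
  exact spike_mem_of_stable K hfac hU h0 (by have := p.2; omega)

/-- **equivalently: a PROPER subspace stable under the two generators is zero.** -/
theorem eq_bot_of_shear_swap_stable_of_ne_top (hfac : (n.factorial : K) ≠ 0) {W : Submodule K (spikeSpan K n)} (hU : ∀ f ∈ W, SbC K 1 1 0 1 f ∈ W)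
    (hS : ∀ f ∈ W, SbC K 0 1 1 0 f ∈ W) (hW : W ≠ ⊤) : W = ⊥ := by
  by_contra h
  exact hW (eq_top_of_shear_swap_stable K hfac hU hS h)

/-- characteristic `0`: irreducible for every `n`. -/
theorem eq_top_of_shear_swap_stable_charZero [CharZero K] {W : Submodule K (spikeSpan K n)} (hU : ∀ f ∈ W, SbC K 1 1 0 1 f ∈ W)
    (hS : ∀ f ∈ W, SbC K 0 1 1 0 f ∈ W) (hW : W ≠ ⊥) : W = ⊤ :=
  eq_top_of_shear_swap_stable K (Nat.cast_ne_zero.2 (Nat.factorial_ne_zero n)) hU hS hW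

end Summit.Ventures.HSemireg.Wedge.HankelFrameChange
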